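import Summits.ValiantsHypothesis.ValiantsHypothesis.Theorems.DepthWindowHomNewtonGadget
import HarnessLib

/-!
# Route `DepthWindow`, g8 — Newton gadget (2/4): references and values of layers `B, W, P, M`

Every layer of the gadget (`DepthWindowHomNewtonGadget`) only references earlier gates, and the
values at the layer positions are: `b_j` (layer `B`), `b_j ^ jj` (`W`), the power sums
`Σ_N b_j ^ jj` (`P`), and `Z · Π_{j ∈ μ} p_j` (`M`).

[cite: LimayeSrinivasanTavenas2025, Lemma 11, Lemma 19, Lemma 20] [cite: Strassen1973, §3]
[cite: Burgisser2000, Def. 2.1]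
-/

-- layout Summits/ValiantsHypothesis/ValiantsHypothesis forces the duplicated namespace component
set_option linter.dupNamespace false

namespace Summit.ValiantsHypothesis.ValiantsHypothesis.Theorems.DepthWindow

open MvPolynomial Literature.Computability.AlgebraicComplexity ArithCircuit
open Literature.Computability.AlgebraicComplexity.DepthReduction

/-! ### References of the layers -/

section Refs

variable {k : Type*} [Field k] {τ : Type*}
variable (i : ℕ) (pos : ℕ → ℕ) (c : ℕ → k) (us : List (Operand k τ)) (d : ℕ)

/-- Translated operands reference the prefix. -/
theorem top_refsBelow {L : ℕ} (hpos : ∀ j < i, pos j < L) :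
    ∀ u : Operand k τ, (top i pos u).RefsBelow L
  | .var _ => trivial
  | .const _ => trivial
  | .gate j => by
      simp only [top]
      split_ifs with h
      · exact hpos j h
      · trivial

/-- Layer `B` references the prefix. -/
theorem layerB_argsBelow {L : ℕ} (hpos : ∀ j < i, pos j < L) :
    ∀ G ∈ layerB i pos c us, ∀ u ∈ G.args, u.RefsBelow L := by
  intro G hG u hu
  simp only [layerB, List.mem_map, List.mem_range] at hG
  obtain ⟨j, hj, rfl⟩ := hG
  unfold gateB at hu
  split_ifs at hu with h
  · simp only [Gate.args, List.map_cons, List.map_nil, List.mem_cons, List.not_mem_nil,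
      or_false] at hu
    rcases hu with rfl | rfl
    · exact hpos j h.1
    · trivial
  · simp [Gate.args] at hu

omit [Field k] in
/-- Layer `W` references layer `B`. -/
theorem layerW_argsBelow (L : ℕ) :
    ∀ G ∈ (layerW i d L : List (Gate k τ)), ∀ u ∈ G.args, u.RefsBelow (L + i) := by
  intro G hG u hu
  simp only [layerW, List.mem_map, List.mem_range] at hG
  obtain ⟨r, hr, rfl⟩ := hG
  simp only [Gate.args] at hu
  obtain rfl := List.eq_of_mem_replicate hu
  show L + r / (d + 1) < L + i
  have : r / (d + 1) < i := (Nat.div_lt_iff_lt_mul (by omega)).mpr hr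
  omega

/-- The operands of the power sums reference layer `W`. -/
theorem argP_refsBelow (L jj : ℕ) (hjj : jj ≤ d) :
    ∀ u : Operand k τ, (argP i c d L jj u).2.RefsBelow (L + i + i * (d + 1))
  | .var _ => trivial
  | .const _ => trivial
  | .gate j => by
      simp only [argP]
      split_ifs with h
      · show L + i + ((d + 1) * j + jj) < L + i + i * (d + 1)
        have h1 : (d + 1) * (j + 1) ≤ (d + 1) * i := Nat.mul_le_mul_left _ h.1
        have h2 : (d + 1) * (j + 1) = (d + 1) * j + (d + 1) := by ring
        have h3 : i * (d + 1) = (d + 1) * i := Nat.mul_comm _ _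
        omega
      · trivial

/-- Layer `P` references layer `W`. -/
theorem layerP_argsBelow (L : ℕ) :
    ∀ G ∈ layerP i c us d L, ∀ u ∈ G.args, u.RefsBelow (L + i + i * (d + 1)) := by
  intro G hG u hu
  simp only [layerP, List.mem_map, List.mem_range] at hG
  obtain ⟨jj, hjj, rfl⟩ := hG
  simp only [Gate.args, List.map_map, List.mem_map, Function.comp_apply] at hu
  obtain ⟨v, _, rfl⟩ := hu
  exact argP_refsBelow i c d L jj (by omega) v

/-- Kept Z-operands are Z-operands. -/
theorem mem_zops_of_mem_zkeep {u : Operand k τ} (hu : u ∈ zkeep i pos c us d) :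
    u ∈ zops i pos c us := by
  unfold zkeep at hu
  split_ifs at hu
  · exact hu
  · simp at hu

/-- Layer `M` references the prefix and layer `P`. -/
theorem layerM_argsBelow {L : ℕ} (hpos : ∀ j < i, pos j < L) :
    ∀ G ∈ layerM i pos c us d L, ∀ u ∈ G.args, u.RefsBelow (L + i + i * (d + 1) + (d + 1)) := by
  intro G hG u hu
  simp only [layerM, List.mem_map] at hG
  obtain ⟨pr, hpr, rfl⟩ := hG
  simp only [Gate.args, List.mem_append, List.mem_map, Multiset.mem_toList] at hu
  rcases hu with hu | ⟨j, hj, rfl⟩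
  · have hu' := mem_zops_of_mem_zkeep i pos c us d hu
    simp only [zops, List.mem_map] at hu'
    obtain ⟨v, _, rfl⟩ := hu'
    exact Operand.refsBelow_mono (by omega) (top_refsBelow i pos hpos v)
  · show L + i + i * (d + 1) + j < L + i + i * (d + 1) + (d + 1)
    have := (le_of_mem_parts pr.2 hj).trans (fst_le_of_mem_pairs hpr)
    omega

variable [Algebra ℚ k] (cc : (kk : ℕ) → kk.Partition → ℚ)

/-- Gate `F` references layer `M`. -/
theorem gateF_argsBelow (L : ℕ) : ∀ u ∈ (gateF i pos c us d L cc).args,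
    u.RefsBelow (L + i + i * (d + 1) + (d + 1) + (pairs d).length) := by
  intro u hu
  unfold gateF at hu
  split_ifs at hu
  · simp only [Gate.args, List.map_map, List.mem_map, List.mem_range, Function.comp_apply] at hu
    obtain ⟨r, hr, rfl⟩ := hu
    show L + i + i * (d + 1) + (d + 1) + r < _
    omega
  · simp [Gate.args] at hu

end Refs

/-! ### Values of the layers -/

section Values

variable {k : Type*} [Field k] {τ : Type*}
variable (i : ℕ) (pos : ℕ → ℕ) (c : ℕ → k) (us : List (Operand k τ)) (d : ℕ)

/-- The new block after layer `B`. -/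
noncomputable def psi1 (Ψ₀ : List (Gate k τ)) : List (Gate k τ) := Ψ₀ ++ layerB i pos c us

/-- The new block after layer `W`. -/
noncomputable def psi2 (Ψ₀ : List (Gate k τ)) : List (Gate k τ) :=
  psi1 i pos c us Ψ₀ ++ layerW i d Ψ₀.length

/-- The new block after layer `P`. -/
noncomputable def psi3 (Ψ₀ : List (Gate k τ)) : List (Gate k τ) :=
  psi2 i pos c us d Ψ₀ ++ layerP i c us d Ψ₀.length

/-- The new block after layer `M`. -/
noncomputable def psi4 (Ψ₀ : List (Gate k τ)) : List (Gate k τ) :=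
  psi3 i pos c us d Ψ₀ ++ layerM i pos c us d Ψ₀.length

variable (Ψ₀ : List (Gate k τ))

/-- `|psi1| = |Ψ₀| + i`. -/
theorem length_psi1 : (psi1 i pos c us Ψ₀).length = Ψ₀.length + i := by
  rw [psi1, List.length_append, length_layerB]

/-- `|psi2| = |Ψ₀| + i + i(d+1)`. -/
theorem length_psi2 : (psi2 i pos c us d Ψ₀).length = Ψ₀.length + i + i * (d + 1) := by
  rw [psi2, List.length_append, length_psi1, length_layerW]

/-- `|psi3| = |Ψ₀| + i + i(d+1) + (d+1)`. -/
theorem length_psi3 : (psi3 i pos c us d Ψ₀).length = Ψ₀.length + i + i * (d + 1) + (d + 1) := by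
  rw [psi3, List.length_append, length_psi2, length_layerP]

/-- `|psi4| = |Ψ₀| + i + i(d+1) + (d+1) + |pairs d|`. -/
theorem length_psi4 : (psi4 i pos c us d Ψ₀).length =
    Ψ₀.length + i + i * (d + 1) + (d + 1) + (pairs d).length := by
  rw [psi4, List.length_append, length_psi3, length_layerM]

/-- `psi3` extends `Ψ₀`. -/
theorem psi3_eq_append : psi3 i pos c us d Ψ₀ =
    Ψ₀ ++ (layerB i pos c us ++ layerW i d Ψ₀.length ++ layerP i c us d Ψ₀.length) := by
  simp [psi3, psi2, psi1, List.append_assoc]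

variable {Ψ₀}

/-- **Layer `B` values**: position `|Ψ₀| + j` holds `b_j`. -/
theorem getD_psi1 (hpos : ∀ j < i, pos j < Ψ₀.length) {j : ℕ} (hj : j < i) :
    (gateValues (psi1 i pos c us Ψ₀)).getD (Ψ₀.length + j) 0 =
      (gateB i pos c us j).eval (gateValues Ψ₀) := by
  rw [psi1, gateValues_layer Ψ₀ _ (layerB_argsBelow i pos c us hpos), ← gateValues_length Ψ₀,
    getD_append_length_add, layerB, List.map_map]
  rw [getD_map_range_ite, if_pos hj]; rfl

/-- **Layer `W` values**: position `|Ψ₀| + i + ((d+1) j + jj)` holds `b_j ^ jj`. -/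
theorem getD_psi2 (hpos : ∀ j < i, pos j < Ψ₀.length) {j jj : ℕ} (hj : j < i) (hjj : jj ≤ d) :
    (gateValues (psi2 i pos c us d Ψ₀)).getD (Ψ₀.length + i + ((d + 1) * j + jj)) 0 =
      (gateB i pos c us j).eval (gateValues Ψ₀) ^ jj := by
  have hr : (d + 1) * j + jj < i * (d + 1) := by
    have h1 : (d + 1) * (j + 1) ≤ (d + 1) * i := Nat.mul_le_mul_left _ hj
    have h2 : (d + 1) * (j + 1) = (d + 1) * j + (d + 1) := by ring
    have h3 : i * (d + 1) = (d + 1) * i := Nat.mul_comm _ _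
    omega
  have hlen : (gateValues (psi1 i pos c us Ψ₀)).length = Ψ₀.length + i := by
    rw [gateValues_length, length_psi1]
  rw [psi2, gateValues_layer _ _ (by
      rw [length_psi1]; exact layerW_argsBelow i d Ψ₀.length),
    ← hlen, getD_append_length_add, layerW, List.map_map, getD_map_range_ite, if_pos hr]
  simp only [Function.comp_apply, eval_prod, List.map_replicate, List.prod_replicate,
    Operand.eval_gate]
  rw [Nat.mul_add_mod, Nat.mod_eq_of_lt (by omega : jj < d + 1),
    Nat.mul_add_div (by omega : 0 < d + 1), Nat.div_eq_of_lt (by omega : jj < d + 1), add_zero,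
    getD_psi1 i pos c us hpos hj]

open Classical in
/-- The "A-value" of an operand: `b_j` for an N-operand `gate j`, else `0`. -/
noncomputable def aval (V₀ : List (MvPolynomial τ k)) : Operand k τ → MvPolynomial τ k
  | .gate j => if j < i ∧ c j ≠ 0 then (gateB i pos c us j).eval V₀ else 0
  | _ => 0

/-- The terms of the power sum `p_jj` are the `jj`-th powers of the A-values (`jj ≥ 1`). -/
theorem argP_term (hpos : ∀ j < i, pos j < Ψ₀.length) {jj : ℕ} (hjj1 : 1 ≤ jj) (hjj : jj ≤ d) :
    ∀ u : Operand k τ,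
      (argP i c d Ψ₀.length jj u).1 • (argP i c d Ψ₀.length jj u).2.eval
          (gateValues (psi2 i pos c us d Ψ₀)) =
        aval i pos c us (gateValues Ψ₀) u ^ jj
  | .var t => by
      simp only [argP, aval, zero_smul]
      rw [zero_pow (by omega)]
  | .const a => by
      simp only [argP, aval, zero_smul]
      rw [zero_pow (by omega)]
  | .gate j => by
      simp only [argP, aval]
      by_cases h : j < i ∧ c j ≠ 0
      · rw [if_pos h, if_pos h]
        simp only [one_smul, Operand.eval_gate]
        exact getD_psi2 i pos c us d hpos h.1 hjj
      · rw [if_neg h, if_neg h]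
        simp only [zero_smul]
        rw [zero_pow (by omega)]

/-- **Layer `P` values**: position `|Ψ₀| + i + i(d+1) + jj` holds `Σ_u aval(u)^jj` (`1 ≤ jj ≤ d`). -/
theorem getD_psi3 (hpos : ∀ j < i, pos j < Ψ₀.length) {jj : ℕ} (hjj1 : 1 ≤ jj) (hjj : jj ≤ d) :
    (gateValues (psi3 i pos c us d Ψ₀)).getD (Ψ₀.length + i + i * (d + 1) + jj) 0 =
      (us.map fun u => aval i pos c us (gateValues Ψ₀) u ^ jj).sum := by
  have hlen : (gateValues (psi2 i pos c us d Ψ₀)).length = Ψ₀.length + i + i * (d + 1) := by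
    rw [gateValues_length, length_psi2]
  rw [psi3, gateValues_layer _ _ (by
      rw [length_psi2]; exact layerP_argsBelow i c us d Ψ₀.length),
    ← hlen, getD_append_length_add, layerP, List.map_map,
    getD_map_range_ite, if_pos (by omega : jj < d + 1)]
  simp only [Function.comp_apply, eval_sum, List.map_map]
  congr 1
  exact List.map_congr_left fun u _ => argP_term i pos c us d hpos hjj1 hjj u

/-- **Layer `M` values**: position `|Ψ₀| + i + i(d+1) + (d+1) + r` holds the product of the kept
Z-operands with `Π_{j ∈ μ_r} p_j`. -/
theorem getD_psi4 (hpos : ∀ j < i, pos j < Ψ₀.length) {r : ℕ} (hr : r < (pairs d).length) :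
    (gateValues (psi4 i pos c us d Ψ₀)).getD (Ψ₀.length + i + i * (d + 1) + (d + 1) + r) 0 =
      ((zkeep i pos c us d).map fun u => u.eval (gateValues Ψ₀)).prod *
        (((pairs d).getD r dfltPair).2.parts.toList.map fun j =>
          (us.map fun u => aval i pos c us (gateValues Ψ₀) u ^ j).sum).prod := by
  have hlen : (gateValues (psi3 i pos c us d Ψ₀)).length =
      Ψ₀.length + i + i * (d + 1) + (d + 1) := by
    rw [gateValues_length, length_psi3]
  rw [psi4, gateValues_layer _ _ (by
      rw [length_psi3]; exact layerM_argsBelow i pos c us d hpos),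
    ← hlen, getD_append_length_add, layerM, List.map_map,
    List.getD_eq_getElem _ _ (by simpa using hr), List.getElem_map,
    List.getD_eq_getElem _ _ hr]
  simp only [Function.comp_apply, eval_prod, List.map_append, List.prod_append, List.map_map]
  obtain ⟨X, hX, -⟩ := gateValues_prefix Ψ₀
    (layerB i pos c us ++ layerW i d Ψ₀.length ++ layerP i c us d Ψ₀.length)
  have hV3 : gateValues (psi3 i pos c us d Ψ₀) = gateValues Ψ₀ ++ X := by
    rw [psi3_eq_append, hX]
  congr 1
  · congr 1
    refine List.map_congr_left fun u hu => ?_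
    have hu' := mem_zops_of_mem_zkeep i pos c us d hu
    simp only [zops, List.mem_map] at hu'
    obtain ⟨v, _, rfl⟩ := hu'
    rw [hV3]
    exact operand_eval_append_of_refsBelow _ _
      ((gateValues_length Ψ₀).symm ▸ top_refsBelow i pos hpos v)
  · congr 1
    refine List.map_congr_left fun j hj => ?_
    rw [Multiset.mem_toList] at hj
    have hj1 : 1 ≤ j := ((pairs d)[r]).2.parts_pos hj
    have hjd : j ≤ d :=
      (le_of_mem_parts _ hj).trans (fst_le_of_mem_pairs (List.getElem_mem hr))
    simp only [Function.comp_apply, Operand.eval_gate]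
    exact getD_psi3 i pos c us d hpos hj1 hjd

end Values

end Summit.ValiantsHypothesis.ValiantsHypothesis.Theorems.DepthWindow
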